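import Literature.MathematicalPhysics.QuantumFieldTheory.Balaban1983to89.Node00.CarriersB8Per
import Literature.MathematicalPhysics.QuantumFieldTheory.Balaban1983to89.Node00.CarriersB8SubBP2D
import Literature.MathematicalPhysics.QuantumFieldTheory.Balaban1983to89.B8LeafModelZdHP2Per
import Literature.MathematicalPhysics.QuantumFieldTheory.Balaban1983to89.B8Prop3PrintedZdGF3P2Gamma

/-!
# NODE 00 (YM-PLAN Track A) — STAGE 3′(X.B8-P₂D-PER): THE PERIODIC RE-PIN OF THE [Balaban1985RegularSpaces] δ₂-GROUP OF RECORD — the P₂D road's member model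
# `B8LeafModelZd3P2.zdGF3HP₂` READ ON THE TORUS: dag-n05-c's `P`-periodic member model `B8LeafModelZdHP2Per.zdGF3HP₂Per` (pen P1′) over this lineage's periodic (1.5)-index
# `IdxB8SubDPer θ P` (`Node00/CarriersB8SubDPer`); the bundle substitution `withB8OfRecordSubBP₂DPer`; the surviving leaf `B8LeafOfRecordSubBP₂DPer` (shape `B8LeafRS`);
# the Stage-5 pin `pinB8SubBP₂DPer` (UP-SIDE); THE DOORS (c₁) ∕ (c₂) to the display of record `B8LeafRS` at `upOfRecord₅CS`

[Balaban1985RegularSpaces] = T. Bałaban, *Spaces of regular gauge field configurations on a lattice and gauge fixing conditions*, Commun. Math. Phys. **99** (1985) 75–102 — p. 77 «Ω_j ⊂ T_η …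
we admit the case where some domains Ω_j are equal to T_η», Lemma 1 p. 79, Thm 2 p. 83, Prop. 3 p. 87, Thm 4 p. 88, Props. 5–7 pp. 94–100, Thm 8 p. 101, (1.35)–(1.37) p. 82, (1.62) p. 87,
(1.66) p. 88, (1.140) p. 100.  [Balaban1985BackgroundPropagators] (3.40) p. 397 (the Hölder seminorm on `Ω_j`: both points of the pair in the domain), Thm 3.3 p. 399.  [Balaban1987RG1] (0.1)
p. 251 (the torus).

NODE 00 CARRIER MODULE (width seat `pub-ymgap-dag-n05-w1` g4, 2026-08-28 — pen P2′ of the (β′-PERIODIC) road under dag-n05-d's P4 ANSWER (ii) (pub-ymgap bus 14:20Z) to dag-n05-c's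
LOCATED-MODEL (14:18Z): «the P₂D road runs on `zdGF3HP₂`; P1′ `zdGF3HP₂Per` + transfer′ (n05-c) + P2′ `CarriersB8SubBP2DPer` (n05-w1); the ∅ display fixes the LEAF SHAPE `B8LeafRS`, not the
member model»).  THIS IS this lineage's g3 `Node00/CarriersB8Per` §1–§3 VERBATIM with the member model swapped `zdGF3Per ↦ zdGF3HP₂Per` (names `…Per ↦ …SubBP₂DPer`); APPEND-ONLY: a NEW
importing module — `CarriersB8Per` (`IdxB8SubDPer`, `ResidB8Per`, `upOfRecord₅CS_b8_iff_of_res_X_eq'`), `CarriersB8SubBP2D` (`proj140_famB8OfRecordSubBP₂D`, the ℤᵈ slot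
`B8LeafOfRecordSubBP₂D` and its projections), P1′ `B8LeafModelZdHP2Per` and dag-n05-d's D3₂ `B8Prop3PrintedZdGF3P2Gamma` CONSUMED BY NAME, nothing edited; no rung text touched (HARD FREEZE
№216 (f)).

WHAT IS PINNED.  At a δ₂-periodically pinned parameter `θ.pinB8SubBP₂DPer P lam` the [B8] group of every run's carrier bundle IS (`PrintedCarriersR.withB8OfRecordSubBP₂DPer`): index
`I8b := IdxB8SubDPer θ P` (periodic (1.5)-members: `Ω_l` `P`-periodic, `Lᵏ ∣ P`, `0 < P`), THE PERIODIC δ₂-FAMILY OF RECORD `famB8OfRecordSubBP₂DPer θ β len P j := zdGF3HP₂Per θ.𝔸 θ.L β len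
j.toZdIdx P` — the `P`-periodic unitary `θ.𝔸`-valued configurations ∕ perturbation pairs ∕ gauge transformations ∕ sources on the bonds of `ℤ^{θ.D}` with EVERY predicate `zdGF3HP₂`'s body
on the underlying fields — its `GFData2` part as `fam8`, its (1.140) ∕ `R(U₀)` predicates as the R-extension with `proj140` PROVED (`CarriersB8SubBP2D.proj140_famB8OfRecordSubBP₂D` at the
underlying fields); Lemma-1 carriers `blockPairNA`; `d8 := θ.D`, `L8 := θ.L`; constants, Prop-5 ∕ Prop-6 carriers and inputs from the residual layer `lam.base : ResidB8 θ` (UNCHANGED TYPE — the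
chain's cuts `ResidB8.cutSubBP₅ …` apply to it verbatim); the residual layer type is `CarriersB8Per.ResidB8Per θ P` REUSED (P1′'s carriers are P1's); Proposition 7's axial gauge map ON THE
PERIODIC FAMILY = the layer's second field `lam.toAxial` (FREE residual data — the display's `p7` slot, X1 census; print's tower-wise map on periodic data is a later pin).  Every other group of
`X` unchanged (`rfl` faces); the pin is UP-SIDE (`datumOfRecord₅_pinB8SubBP₂DPer`) and commutes with the [B10] ∕ Y ∕ Z ∕ W pins (`rfl`); it SUPERSEDES the ℤᵈ pin, the periodic `zdGF3Per` pin
AND the ℤᵈ δ₂-pin (`rfl` ×3).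

THE DOORS (director-ym №217 (1): «periodic data ON the ℤᵈ carrier is exactly what lets the torus road conclude AT that display without re-keying a rung»).  (c₁)
`upOfRecord₅CS_pinB8SubBP₂DPer_b8_iff`: the `b8` leaf of the S-binding at δ₂-periodically pinned Stage-5 parameters IS `B8LeafOfRecordSubBP₂DPer θ P lam` (`Iff.rfl`).  (c₂) EQUATION-KEYED, for
ANY Stage-5 parameters (in particular the Stage-13 view `θ'.toStage5₁₃CoPH F 2` of `K1V9Defs.RecordSV`, whose `res.X` is the FREE residual field): `θ.res.X R = X₀.withB8OfRecordSubBP₂DPer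
θ.toStage3Params P lam → ((upOfRecord₅CS F N θ R).b8 ↔ B8LeafOfRecordSubBP₂DPer θ.toStage3Params P lam)` — DEF-1's door-review pattern (`Cruxes/…/DEF1DoorCReview.lean`: one `rw [hup]` + (c₂))
applies verbatim.  §3: the (E2) ∕ κ doors `_precomp ∕ _subtype` (SECOND-GAP SG-1: a κ-cut of the index is a `Subtype` here), the projections `_t2 ∕ _t4 ∕ _t8` in the shapes dag-n05-c's transfer′
and dag-n05-d's re-keyed chain feed, the pure-∀ Proposition-3 transfer from the ℤᵈ δ₂-slot, and ★ `prop3_famB8OfRecordSubBP₂DPer` — Proposition 3 at the periodic δ₂-family from dag-n06-b's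
BOTH-POINTS socket `SockB9P3H2` at the periodic members only (dag-n05-d's D3₂ BY NAME).

HONEST FRAMING: definitions + kernel bookkeeping (`rfl` ∕ `Iff.rfl` ∕ one induction ∕ one pure-∀ transfer); NO estimate; nothing of [Balaban1985RegularSpaces] asserted; the leaf
`B8LeafOfRecordSubBP₂DPer` is a PROPOSITION (N05's display over periodic δ₂-members), NOT proved here; N05 NOT discharged (№217 (1)(b), (2): judged at this display with the `c₁ ∕ ρ₀` guard
carried; SECOND-GAP SG-1 (the class `IdxB8SubD(Per) ⊋` print's (1.3)–(1.4)) DECLARED, not cut); counts unmoved; one finite T⁴ programme at fixed ε, Bałaban AS PRINTED — NOT continuum ∕ ℝ⁴ ∕ OS ∕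
mass gap ∕ Clay.  No `sorry`, no `axiom`, no `instance`, no `notation`. -/

noncomputable section

namespace Literature.MathematicalPhysics.QuantumFieldTheory.Balaban1983to89.Node00

open T4Continuum AveragingRT T4FiniteEpsInhabited FlowStep FlowStepRuns DagBinding T4DatumAssembly
open B8LeafKnitRS (B8LeafRS)
open B8LeafModelZd (ZdIdx)
open B8LeafModelZd3 (zdGF3)
open B8LeafModelZd3P2 (zdGF3P₂ zdGF3HP₂)
open B8LeafModelZdPer (zdGF3Per)
open B8LeafModelZdHP2Per (zdGF3HP₂Per cfgZdH pertZdH)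
open B8TowerBondsPrinted (towerBondsP)
open B9SupplySockB9P3ZdGammaUnivDelta2 (SockB9P3H2)
open B8Lemma1NonAbelian (blockPairNA)
open scoped Matrix.Norms.L2Operator

/-! ## §1. The periodic δ₂-family of record (the P₂D road's member model read on periodic data), the two carrier laws, the group of record and what its leaf says -/

section Bundle

variable (θ : Stage3Params)

/-- **THE PERIODIC δ₂-FAMILY OF RECORD** over the periodic (1.5)-index: member `j ↦ zdGF3HP₂Per θ.𝔸 θ.L β len j.toZdIdx P` (dag-n05-c's P1′ WORDING, pub-ymgap bus 2026-08-28 14:18Z ∕ 14:23Z) —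
the `P`-periodic unitary `θ.𝔸`-valued data on the bonds of `ℤ^{θ.D}`, every predicate ∕ norm THE P₂D ROAD's `zdGF3HP₂`'s on the underlying fields ((1.35) ∕ (1.66) in the one-end-point class `EndBlockIn`,
(1.37) over print's `towerBondsP`, the Hölder member of (1.36) over pairs with BOTH points in `Ω_j`, Theorem 8's four-clause `InR`); print's theorems live on the finite torus `T_η` (p. 77).
[cite: Balaban1985RegularSpaces, p.77 («Ω_j ⊂ T_η»), (1.29) p.81, (1.33)–(1.39) p.82, (1.40) p.83, (1.62) p.87, (1.66) p.88, (1.140) p.100, (1.146) p.101; Balaban1985BackgroundPropagators, (3.40) p.397] -/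
def famB8OfRecordSubBP₂DPer (β : ℝ) (len : B7Prop1Explicit.Site θ.D → ℝ) (P : ℕ) (j : IdxB8SubDPer θ P) : B8SectGH.GFData3 :=
  zdGF3HP₂Per θ.𝔸 θ.L β len j.toZdIdx P

/-- The family unfolded at the member's `ZdIdx` (`rfl`). [cite: Balaban1985RegularSpaces, (1.29) p.81 (bookkeeping)] -/
theorem famB8OfRecordSubBP₂DPer_eq (β : ℝ) (len : B7Prop1Explicit.Site θ.D → ℝ) (P : ℕ) (j : IdxB8SubDPer θ P) :
    famB8OfRecordSubBP₂DPer θ β len P j = zdGF3HP₂Per θ.𝔸 θ.L β len j.1.1.1.1.1 P := rfl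

/-- The family's level count is the member's depth (`rfl`). [cite: Balaban1985RegularSpaces, p.77 (bookkeeping)] -/
theorem famB8OfRecordSubBP₂DPer_k (β : ℝ) (len : B7Prop1Explicit.Site θ.D → ℝ) (P : ℕ) (j : IdxB8SubDPer θ P) :
    (famB8OfRecordSubBP₂DPer θ β len P j).k = j.1.1.1.1.1.k := rfl

/-! THE RESIDUAL LAYER is `CarriersB8Per.ResidB8Per θ P` VERBATIM (REUSED, not re-declared): its axial slot `toAxial j : Cfg → Pert → Pert` is typed over P1's carriers, which ARE
P1′'s (`zdGF3HP₂Per`'s configurations ∕ perturbation pairs are the same `P`-periodic unitary subtypes — dag-n05-c, «P1's carriers (`rfl`)»), so one residual layer serves both periodic pins. -/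

variable {θ}

/-- **THE R-EXTENSION LAW `proj140` HOLDS ON THE PERIODIC δ₂-FAMILY** — `CarriersB8SubBP2D.proj140_famB8OfRecordSubBP₂D` at the underlying ℤᵈ fields (P1′'s predicates are `zdGF3HP₂`'s bodies on `.1`).
[cite: Balaban1985RegularSpaces, (1.140) p.100, (1.62) p.87] -/
theorem proj140_famB8OfRecordSubBP₂DPer (β : ℝ) (len : B7Prop1Explicit.Site θ.D → ℝ) (P : ℕ) (j : IdxB8SubDPer θ P) (α₂ : ℝ) (U₀ : (famB8OfRecordSubBP₂DPer θ β len P j).Cfg)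
    (U₁ : (famB8OfRecordSubBP₂DPer θ β len P j).Pert) (h : (famB8OfRecordSubBP₂DPer θ β len P j).C140 α₂ U₀ U₁) : (famB8OfRecordSubBP₂DPer θ β len P j).C162 1 α₂ U₀ U₁ :=
  proj140_famB8OfRecordSubBP₂D β len j.toSubD α₂ (cfgZdH U₀) (pertZdH U₁) h

/-- **THE CARRIER LAW (1.36) ⊂ (1.62) HOLDS ON THE PERIODIC δ₂-FAMILY** (the first clause of the δ₂ letter IS (1.62)). [cite: Balaban1985RegularSpaces, (1.36) p.82, (1.62) p.87] -/
theorem C136_C162_famB8OfRecordSubBP₂DPer (β : ℝ) (len : B7Prop1Explicit.Site θ.D → ℝ) (P : ℕ) (j : IdxB8SubDPer θ P) (b b₂ s : ℝ) (U₀ : (famB8OfRecordSubBP₂DPer θ β len P j).Cfg)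
    (U₁ : (famB8OfRecordSubBP₂DPer θ β len P j).Pert) (h : (famB8OfRecordSubBP₂DPer θ β len P j).C136 b b₂ s U₀ U₁) : (famB8OfRecordSubBP₂DPer θ β len P j).C162 b s U₀ U₁ :=
  h.1

/-- **THE PERIODIC δ₂-GROUP OF RECORD substituted into a carrier bundle** `X`: index `IdxB8SubDPer θ P`, gauge-fixing family `famB8OfRecordSubBP₂DPer θ β len P` (its `GFData2` part as `fam8`, its
(1.140) ∕ `R(U₀)` predicates as the R-extension, `proj140` proved), Lemma-1 carriers `blockPairNA θ.D θ.L θ.𝔸`, `d8 := θ.D`, `L8 := θ.L`, Prop. 5's `B₀′ := inp.B₀′`, the other carriers and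
constants from `lam.base`, the axial map `lam.toAxial` (FREE residual data — the display's Proposition-7 slot; print's tower-wise map on periodic data is a later pin); every other group of `X`
unchanged. [cite: Balaban1985RegularSpaces, Lemma 1 p.79 – Thm 8 p.101 (the carriers of the typed statements); p.77 («Ω_j ⊂ T_η»)] -/
def _root_.Literature.MathematicalPhysics.QuantumFieldTheory.Balaban1983to89.DagBinding.PrintedCarriersR.withB8OfRecordSubBP₂DPer (X : PrintedCarriersR)
    (θ : Stage3Params) (P : ℕ) (lam : ResidB8Per θ P) : PrintedCarriersR :=
  { X with
    I8a := B7Prop1Explicit.Site θ.D × Fin θ.D, I8b := IdxB8SubDPer θ P, I8c := lam.base.I8c, I8d := lam.base.I8d, d8 := θ.D, L8 := θ.L,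
    C₂ := lam.base.C₂, B₁' := lam.base.B₁', B₀' := lam.base.inp.B₀', B₁ := lam.base.B₁, B₂ := lam.base.B₂, c₁ := lam.base.c₁, inp8 := lam.base.inp, B₀β := lam.base.B₀β,
    loc8 := blockPairNA θ.D θ.L θ.𝔸, fam8 := fun j => (famB8OfRecordSubBP₂DPer θ lam.base.β lam.base.len P j).toGFData2, lan8 := lam.base.lan, cub8 := lam.base.cub,
    toAxial8 := lam.toAxial,
    C140 := fun j => (famB8OfRecordSubBP₂DPer θ lam.base.β lam.base.len P j).C140, InR := fun j => (famB8OfRecordSubBP₂DPer θ lam.base.β lam.base.len P j).InR,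
    proj140 := fun j α₂ U₀ U₁ h => proj140_famB8OfRecordSubBP₂DPer lam.base.β lam.base.len P j α₂ U₀ U₁ h }

/-- **THE `b8` LEAF AT THE PERIODIC GROUP OF RECORD, IN ITS SURVIVING FORM** (`B8LeafKnitRS.B8LeafRS`: Lemma 1 p. 79, Thm 2 p. 83, Prop. 3 p. 87, Thm 4 p. 88, Prop. 5 p. 94, Prop. 6 p. 99,
Prop. 7 p. 100 faithful, Thm 8 p. 101 SURVIVING at γ = 1) over the PERIODIC δ₂-family of record at the residual layer `lam` — N05's display `B8LeafRS` (director-ym №216 (i): the leaf SHAPE of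
record) read on the P₂D road's member model with periodic data (dag-n05-d P4 ANSWER (ii), 2026-08-28 14:20Z).  A PROPOSITION, not proved here; its eight non-`p7` conjuncts are the targets of
dag-n05-d's re-keyed 13-module chain, `p7` is the display's free-axial-map slot.
[cite: Balaban1985RegularSpaces, Lemma 1 p.79, Thm 2 p.83, Prop. 3 p.87, Thm 4 p.88, Prop. 5 p.94, Prop. 6 p.99, Prop. 7 p.100, Thm 8 p.101 (surviving form, GAPS G-B8-13); p.77 («Ω_j ⊂ T_η»)] -/
def B8LeafOfRecordSubBP₂DPer (θ : Stage3Params) (P : ℕ) (lam : ResidB8Per θ P) : Prop :=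
  B8LeafRS θ.D (θ.L : ℝ) lam.base.C₂ lam.base.B₁' lam.base.inp.B₀' lam.base.B₁ lam.base.B₂ lam.base.c₁ lam.base.inp lam.base.B₀β (blockPairNA θ.D θ.L θ.𝔸)
    (famB8OfRecordSubBP₂DPer θ lam.base.β lam.base.len P) lam.base.lan lam.base.cub lam.toAxial

/-- The surviving leaf over the SUBSTITUTED bundle's own [B8] group IS `B8LeafOfRecordSubBP₂DPer θ P lam` (`Iff.rfl`). [cite: Balaban1985RegularSpaces, Lemma 1 – Thm 8 pp.79–101 (bookkeeping)] -/
theorem b8LeafRS_withB8OfRecordSubBP₂DPer_iff (X : PrintedCarriersR) (θ : Stage3Params) (P : ℕ) (lam : ResidB8Per θ P) :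
    B8LeafRS (X.withB8OfRecordSubBP₂DPer θ P lam).d8 (X.withB8OfRecordSubBP₂DPer θ P lam).L8 (X.withB8OfRecordSubBP₂DPer θ P lam).C₂ (X.withB8OfRecordSubBP₂DPer θ P lam).B₁'
        (X.withB8OfRecordSubBP₂DPer θ P lam).B₀' (X.withB8OfRecordSubBP₂DPer θ P lam).B₁ (X.withB8OfRecordSubBP₂DPer θ P lam).B₂ (X.withB8OfRecordSubBP₂DPer θ P lam).c₁ (X.withB8OfRecordSubBP₂DPer θ P lam).inp8
        (X.withB8OfRecordSubBP₂DPer θ P lam).B₀β (X.withB8OfRecordSubBP₂DPer θ P lam).loc8 (X.withB8OfRecordSubBP₂DPer θ P lam).fam8R (X.withB8OfRecordSubBP₂DPer θ P lam).lan8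
        (X.withB8OfRecordSubBP₂DPer θ P lam).cub8 (X.withB8OfRecordSubBP₂DPer θ P lam).toAxial8 ↔
      B8LeafOfRecordSubBP₂DPer θ P lam :=
  Iff.rfl

/-- The substitution's index IS the periodic (1.5)-index (`rfl`). [cite: Balaban1985RegularSpaces, p.77 (bookkeeping)] -/
theorem withB8OfRecordSubBP₂DPer_I8b (X : PrintedCarriersR) (θ : Stage3Params) (P : ℕ) (lam : ResidB8Per θ P) : (X.withB8OfRecordSubBP₂DPer θ P lam).I8b = IdxB8SubDPer θ P := rfl

/-- The substitution's `GFData2` family IS P1′'s periodic δ₂-model at the members (`rfl`). [cite: Balaban1985RegularSpaces, (1.33)–(1.40) pp.82–83 (bookkeeping)] -/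
theorem withB8OfRecordSubBP₂DPer_fam8 (X : PrintedCarriersR) (θ : Stage3Params) (P : ℕ) (lam : ResidB8Per θ P) :
    (X.withB8OfRecordSubBP₂DPer θ P lam).fam8 = fun j : IdxB8SubDPer θ P => (zdGF3HP₂Per θ.𝔸 θ.L lam.base.β lam.base.len j.1.1.1.1.1 P).toGFData2 := rfl

/-- The substitution's re-packaged `GFData3` family `fam8R` IS the periodic δ₂-family of record (`rfl`, structure eta). [cite: Balaban1985RegularSpaces, (1.33)–(1.40) pp.82–83, (1.140) p.100 (bookkeeping)] -/
theorem withB8OfRecordSubBP₂DPer_fam8R (X : PrintedCarriersR) (θ : Stage3Params) (P : ℕ) (lam : ResidB8Per θ P) :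
    (X.withB8OfRecordSubBP₂DPer θ P lam).fam8R = famB8OfRecordSubBP₂DPer θ lam.base.β lam.base.len P := rfl

/-- The substitution's axial map IS the layer's periodic axial map (`rfl`). [cite: Balaban1985RegularSpaces, Prop. 7 p.100 (bookkeeping)] -/
theorem withB8OfRecordSubBP₂DPer_toAxial8 (X : PrintedCarriersR) (θ : Stage3Params) (P : ℕ) (lam : ResidB8Per θ P) : (X.withB8OfRecordSubBP₂DPer θ P lam).toAxial8 = lam.toAxial := rfl

/-- The substitution does not touch the [B10] group (`rfl`) … [cite: Balaban1985UV3, (1)–(5) p.256 (bookkeeping)] -/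
theorem withB8OfRecordSubBP₂DPer_runs10 (X : PrintedCarriersR) (θ : Stage3Params) (P : ℕ) (lam : ResidB8Per θ P) : (X.withB8OfRecordSubBP₂DPer θ P lam).runs10 = X.runs10 := rfl

/-- … nor the [B12 §§2–5] group (`rfl` ×2) … [cite: Balaban1987RG1, Lemma 4 p.280 (bookkeeping)] -/
theorem withB8OfRecordSubBP₂DPer_F12_c12 (X : PrintedCarriersR) (θ : Stage3Params) (P : ℕ) (lam : ResidB8Per θ P) :
    (X.withB8OfRecordSubBP₂DPer θ P lam).F12 = X.F12 ∧ (X.withB8OfRecordSubBP₂DPer θ P lam).c12 = X.c12 := ⟨rfl, rfl⟩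

/-- … nor the [B13] group (`rfl` ×2) … [cite: Balaban1988RG2Cluster, Lemmas 1–3 pp.9–20 (bookkeeping)] -/
theorem withB8OfRecordSubBP₂DPer_S13_c13 (X : PrintedCarriersR) (θ : Stage3Params) (P : ℕ) (lam : ResidB8Per θ P) :
    (X.withB8OfRecordSubBP₂DPer θ P lam).S13 = X.S13 ∧ (X.withB8OfRecordSubBP₂DPer θ P lam).c13 = X.c13 := ⟨rfl, rfl⟩

/-- … commutes with the [B10] re-binding `withRuns10` (`rfl`) … [cite: Balaban1985UV3, (1)–(5) p.256 (bookkeeping)] -/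
theorem withRuns10_withB8OfRecordSubBP₂DPer (X : PrintedCarriersR) {J : Type} (r : J → B10.RunData) (θ : Stage3Params) (P : ℕ) (lam : ResidB8Per θ P) :
    (X.withRuns10 r).withB8OfRecordSubBP₂DPer θ P lam = (X.withB8OfRecordSubBP₂DPer θ P lam).withRuns10 r := rfl

/-- … with the [B12] substitution `withB12` (`rfl`) … [cite: Balaban1987RG1, Lemma 4 p.280 (bookkeeping)] -/
theorem withB12_withB8OfRecordSubBP₂DPer (X : PrintedCarriersR) (F12 : B12Sec2to5.Lemma4Frame) (c12 : B12Sec2to5.Lemma4Consts) (θ : Stage3Params) (P : ℕ) (lam : ResidB8Per θ P) :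
    (X.withB12 F12 c12).withB8OfRecordSubBP₂DPer θ P lam = (X.withB8OfRecordSubBP₂DPer θ P lam).withB12 F12 c12 := rfl

/-- … and passes through the Stage-3 substitutions `carriers₃` (B4 ∕ B5 ∕ B6 ∕ B7 groups; `rfl`). [cite: Balaban1984PropagatorsII, pp.223–250 (bookkeeping)] -/
theorem carriers₃_withB8OfRecordSubBP₂DPer (θ₃ : Stage3Params) (X : PrintedCarriersR) (θ : Stage3Params) (P : ℕ) (lam : ResidB8Per θ P) :
    carriers₃ θ₃ (X.withB8OfRecordSubBP₂DPer θ P lam) = (carriers₃ θ₃ X).withB8OfRecordSubBP₂DPer θ P lam := rfl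

/-- **THE PERIODIC δ₂-PIN SUPERSEDES THE ℤᵈ PIN** (`rfl`: the same [B8] fields are overwritten) … [cite: Balaban1985RegularSpaces, Lemma 1 – Thm 8 pp.79–101 (bookkeeping)] -/
theorem withB8OfRecord_withB8OfRecordSubBP₂DPer (X : PrintedCarriersR) (θ : Stage3Params) (lam₀ : ResidB8 θ) (P : ℕ) (lam : ResidB8Per θ P) :
    (X.withB8OfRecord θ lam₀).withB8OfRecordSubBP₂DPer θ P lam = X.withB8OfRecordSubBP₂DPer θ P lam := rfl

/-- … the periodic `zdGF3Per` pin of `CarriersB8Per` (`rfl`) … [cite: Balaban1985RegularSpaces, Lemma 1 – Thm 8 pp.79–101 (bookkeeping)] -/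
theorem withB8OfRecordPer_withB8OfRecordSubBP₂DPer (X : PrintedCarriersR) (θ : Stage3Params) (P : ℕ) (lam₁ lam : ResidB8Per θ P) :
    (X.withB8OfRecordPer θ P lam₁).withB8OfRecordSubBP₂DPer θ P lam = X.withB8OfRecordSubBP₂DPer θ P lam := rfl

/-- … and the ℤᵈ δ₂-pin `withB8OfRecordSubBP₂D` of `CarriersB8SubBP2D` (`rfl`). [cite: Balaban1985RegularSpaces, Lemma 1 – Thm 8 pp.79–101 (bookkeeping)] -/
theorem withB8OfRecordSubBP₂D_withB8OfRecordSubBP₂DPer (X : PrintedCarriersR) (θ : Stage3Params) (lam₀ : ResidB8 θ) (P : ℕ) (lam : ResidB8Per θ P) :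
    (X.withB8OfRecordSubBP₂D θ lam₀).withB8OfRecordSubBP₂DPer θ P lam = X.withB8OfRecordSubBP₂DPer θ P lam := rfl

/-- Non-vacuity of the re-pin's index at every period `P > 0` with `L ∣ P` (`nonempty_idxB8SubDPer`: print's all-torus tower). [cite: Balaban1985RegularSpaces, p.77 («we admit Ω_j = T_η»; bookkeeping)] -/
theorem nonempty_I8b_withB8OfRecordSubBP₂DPer (X : PrintedCarriersR) (θ : Stage3Params) {P : ℕ} (hP : 0 < P) (hdvd : θ.L ∣ P) (lam : ResidB8Per θ P) :
    Nonempty (X.withB8OfRecordSubBP₂DPer θ P lam).I8b :=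
  nonempty_idxB8SubDPer θ hP hdvd

end Bundle

/-! ## §2. The pin on Stage-5 parameters (UP-SIDE), the S-binding at the pin, THE DOOR -/

section Pin

variable (F : T4Family) (N : ℕ) [NeZero N]

/-- **The periodic [B8] pin of a Stage-5 residual**: every run's carrier bundle `X R` with its [B8] group := the periodic group of record at `(θ, P, lam)`; every other field unchanged.
[cite: Balaban1985RegularSpaces, Lemma 1 – Thm 8 pp.79–101 (the objects the leaf `b8` reads); p.77 («Ω_j ⊂ T_η»)] -/
def Residual₅.pinB8SubBP₂DPer (r : Residual₅ F N) (θ : Stage3Params) (P : ℕ) (lam : ResidB8Per θ P) : Residual₅ F N :=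
  { r with X := fun R => (r.X R).withB8OfRecordSubBP₂DPer θ P lam }

/-- **The periodic [B8] pin of Stage-5 parameters** (the residual layer typed over the parameters' OWN Stage-3 dictionary). [cite: Balaban1985RegularSpaces, Thm 2 p.83 (objects of record, Stage 3′(X.B8-PER))] -/
def Stage5Params.pinB8SubBP₂DPer (θ : Stage5Params F N) (P : ℕ) (lam : ResidB8Per θ.toStage3Params P) : Stage5Params F N :=
  { θ with res := θ.res.pinB8SubBP₂DPer F N θ.toStage3Params P lam }

/-- The pinned carrier family, unfolded (`rfl`). [cite: Balaban1985RegularSpaces, Lemma 1 – Thm 8 pp.79–101 (bookkeeping)] -/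
theorem Stage5Params.pinB8SubBP₂DPer_X (θ : Stage5Params F N) (P : ℕ) (lam : ResidB8Per θ.toStage3Params P) (R : B12.RunParams) :
    (θ.pinB8SubBP₂DPer F N P lam).res.X R = (θ.res.X R).withB8OfRecordSubBP₂DPer θ.toStage3Params P lam := rfl

/-- The pin touches neither the Stage-3 dictionary (`rfl`) … [cite: Balaban1984PropagatorsII, pp.223–250 (bookkeeping)] -/
theorem Stage5Params.pinB8SubBP₂DPer_toStage3Params (θ : Stage5Params F N) (P : ℕ) (lam : ResidB8Per θ.toStage3Params P) :
    (θ.pinB8SubBP₂DPer F N P lam).toStage3Params = θ.toStage3Params := rfl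

/-- … nor admissibility (`Iff.rfl`) … [cite: Balaban1983RegularityDecay, (1.6) p.572 (hypothesis dictionary; bookkeeping)] -/
theorem Stage5Params.pinB8SubBP₂DPer_admissible_iff (θ : Stage5Params F N) (P : ℕ) (lam : ResidB8Per θ.toStage3Params P) :
    (θ.pinB8SubBP₂DPer F N P lam).Admissible ↔ θ.Admissible := Iff.rfl

/-- … nor the density tower (induction on `k`) … [cite: Balaban1988Convergent, (0.2) p.244 (bookkeeping)] -/
theorem densOfRecord₅_pinB8SubBP₂DPer (θ : Stage5Params F N) (P : ℕ) (lam : ResidB8Per θ.toStage3Params P) (p : B12.RunParams) :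
    ∀ k, densOfRecord₅ F N (θ.pinB8SubBP₂DPer F N P lam) p k = densOfRecord₅ F N θ p k
  | 0 => rfl
  | k + 1 => by
    show θ.res.R p k (TrhoOfRecord F N p.K k (densOfRecord₅ F N (θ.pinB8SubBP₂DPer F N P lam) p k)) =
      θ.res.R p k (TrhoOfRecord F N p.K k (densOfRecord₅ F N θ p k))
    rw [densOfRecord₅_pinB8SubBP₂DPer θ P lam p k]

/-- … nor the machine … [cite: Balaban1988Convergent, (0.2) p.244 (bookkeeping)] -/
theorem machineOfRecord₅_pinB8SubBP₂DPer (θ : Stage5Params F N) (P : ℕ) (lam : ResidB8Per θ.toStage3Params P) :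
    machineOfRecord₅ F N (θ.pinB8SubBP₂DPer F N P lam) = machineOfRecord₅ F N θ := by
  unfold machineOfRecord₅
  simp only [densOfRecord₅_pinB8SubBP₂DPer]
  rfl

/-- … nor the assembled datum: THE PIN IS UP-SIDE. [cite: Balaban1988Convergent, (0.2) p.244 (bookkeeping)] -/
theorem datumOfRecord₅_pinB8SubBP₂DPer (θ : Stage5Params F N) (P : ℕ) (lam : ResidB8Per θ.toStage3Params P) :
    datumOfRecord₅ F N (θ.pinB8SubBP₂DPer F N P lam) = datumOfRecord₅ F N θ := by
  unfold datumOfRecord₅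
  rw [machineOfRecord₅_pinB8SubBP₂DPer]

/-- The periodic [B8] pin COMMUTES with the [B10] pin (`rfl`) … [cite: Balaban1985UV3, (1)–(5) p.256; Balaban1985RegularSpaces, Thm 2 p.83 (bookkeeping)] -/
theorem Stage5Params.pinB8SubBP₂DPer_pinB10 (θ : Stage5Params F N) (P : ℕ) (lam : ResidB8Per θ.toStage3Params P) :
    (θ.pinB8SubBP₂DPer F N P lam).pinB10 F N = (θ.pinB10 F N).pinB8SubBP₂DPer F N P lam := rfl

/-- … with the Y pin (`rfl`) … [cite: Balaban1985BackgroundPropagators, Thm 3.1 p.397 (bookkeeping)] -/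
theorem Stage5Params.pinB8SubBP₂DPer_pinY (θ : Stage5Params F N) (P : ℕ) (lam : ResidB8Per θ.toStage3Params P) (Y₀ : PrintedCarriers9X) :
    (θ.pinB8SubBP₂DPer F N P lam).pinY F N Y₀ = (θ.pinY F N Y₀).pinB8SubBP₂DPer F N P lam := rfl

/-- … with the Z pin (`rfl`) … [cite: Balaban1985Variational, Thm 1 p.279 (bookkeeping)] -/
theorem Stage5Params.pinB8SubBP₂DPer_pinZ (θ : Stage5Params F N) (P : ℕ) (lam : ResidB8Per θ.toStage3Params P) (Z₀ : PrintedCarriers11) :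
    (θ.pinB8SubBP₂DPer F N P lam).pinZ F N Z₀ = (θ.pinZ F N Z₀).pinB8SubBP₂DPer F N P lam := rfl

/-- … with the W pin (`rfl`) … [cite: Balaban1989LargeFieldI, (0.2) p.176 (bookkeeping)] -/
theorem Stage5Params.pinB8SubBP₂DPer_pinW (θ : Stage5Params F N) (P : ℕ) (lam : ResidB8Per θ.toStage3Params P) (W₀ : B12.RunParams → PrintedCarriers15) :
    (θ.pinB8SubBP₂DPer F N P lam).pinW F N W₀ = (θ.pinW F N W₀).pinB8SubBP₂DPer F N P lam := rfl

/-- … and SUPERSEDES the ℤᵈ [B8] pin (`rfl`). [cite: Balaban1985RegularSpaces, Thm 2 p.83 (bookkeeping)] -/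
theorem Stage5Params.pinB8_pinB8SubBP₂DPer (θ : Stage5Params F N) (lam₀ : ResidB8 θ.toStage3Params) (P : ℕ) (lam : ResidB8Per θ.toStage3Params P) :
    (θ.pinB8 F N lam₀).pinB8SubBP₂DPer F N P lam = θ.pinB8SubBP₂DPer F N P lam := rfl

/-- … and the periodic `zdGF3Per` pin `pinB8Per` (`rfl`). [cite: Balaban1985RegularSpaces, Thm 2 p.83 (bookkeeping)] -/
theorem Stage5Params.pinB8Per_pinB8SubBP₂DPer (θ : Stage5Params F N) (P : ℕ) (lam₁ lam : ResidB8Per θ.toStage3Params P) :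
    (θ.pinB8Per F N P lam₁).pinB8SubBP₂DPer F N P lam = θ.pinB8SubBP₂DPer F N P lam := rfl

/-- The C-binding's `b9` leaf does not read the [B8] group (`rfl`; stated ALONE) … [cite: Balaban1985BackgroundPropagators, Thm 3.1 p.397 (bookkeeping)] -/
theorem upOfRecord₅C_pinB8SubBP₂DPer_b9 (θ : Stage5Params F N) (P : ℕ) (lam : ResidB8Per θ.toStage3Params P) (R : B12.RunParams) :
    (upOfRecord₅C F N (θ.pinB8SubBP₂DPer F N P lam) R).b9 = (upOfRecord₅C F N θ R).b9 := rfl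

/-- … nor does `b11` (`rfl`) … [cite: Balaban1985Variational, Thm 1 p.279 (bookkeeping)] -/
theorem upOfRecord₅C_pinB8SubBP₂DPer_b11 (θ : Stage5Params F N) (P : ℕ) (lam : ResidB8Per θ.toStage3Params P) (R : B12.RunParams) :
    (upOfRecord₅C F N (θ.pinB8SubBP₂DPer F N P lam) R).b11 = (upOfRecord₅C F N θ R).b11 := rfl

/-- … nor `rBasicStep` (`rfl`) … [cite: Balaban1989LargeFieldI, Prop. 1 p.194 (bookkeeping)] -/
theorem upOfRecord₅C_pinB8SubBP₂DPer_rBasicStep (θ : Stage5Params F N) (P : ℕ) (lam : ResidB8Per θ.toStage3Params P) (R : B12.RunParams) :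
    (upOfRecord₅C F N (θ.pinB8SubBP₂DPer F N P lam) R).rBasicStep = (upOfRecord₅C F N θ R).rBasicStep := rfl

/-- … nor does `b10` (the compact [B10] node reads the run family only; through `carriers₃_withB8OfRecordSubBP₂DPer`). [cite: Balaban1985UV3, Thm 1 p.257 + Thm 2 p.272 (bookkeeping)] -/
theorem upOfRecord₅C_pinB8SubBP₂DPer_b10_iff (θ : Stage5Params F N) (P : ℕ) (lam : ResidB8Per θ.toStage3Params P) (R : B12.RunParams) :
    (upOfRecord₅C F N (θ.pinB8SubBP₂DPer F N P lam) R).b10 ↔ (upOfRecord₅C F N θ R).b10 := by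
  rw [upOfRecord₅C_b10_iff, upOfRecord₅C_b10_iff, Stage5Params.pinB8SubBP₂DPer_toStage3Params, Stage5Params.pinB8SubBP₂DPer_X, carriers₃_withB8OfRecordSubBP₂DPer]
  exact Iff.rfl

/-- ★★★ **THE DOOR (c₁): THE `b8` LEAF OF THE S-BINDING AT δ₂-PERIODICALLY PINNED PARAMETERS IS THE SURVIVING LEAF AT THE PERIODIC δ₂-GROUP OF RECORD** (`Iff.rfl` through
`carriers₃_withB8OfRecordSubBP₂DPer`) — N05's display `B8LeafRS` at `upOfRecord₅CS`, read with periodic data, by name. [cite: Balaban1985RegularSpaces, Lemma 1 – Thm 8 pp.79–101 (the leaf at the objects of record); p.77 («Ω_j ⊂ T_η»)] -/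
theorem upOfRecord₅CS_pinB8SubBP₂DPer_b8_iff (θ : Stage5Params F N) (P : ℕ) (lam : ResidB8Per θ.toStage3Params P) (R : B12.RunParams) :
    (upOfRecord₅CS F N (θ.pinB8SubBP₂DPer F N P lam) R).b8 ↔ B8LeafOfRecordSubBP₂DPer θ.toStage3Params P lam :=
  Iff.rfl

/-- ★★ **THE DOOR (c₂), EQUATION-KEYED — FOR ANY STAGE-5 PARAMETERS WHOSE RUN-`R` CARRIER BUNDLE IS A PERIODICALLY SUBSTITUTED ONE** (in particular the Stage-13 view
`θ'.toStage5₁₃CoPH F 2` of `K1V9Defs.RecordSV`, whose `res.X` is the free residual field): the S-binding's `b8` leaf IS `B8LeafOfRecordSubBP₂DPer` — so the K1 witness reaches N05's display with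
periodic δ₂-data WITHOUT a Stage-13 pin and WITHOUT re-keying a rung (director-ym №217 (1); `CarriersB8Per.upOfRecord₅CS_b8_iff_of_res_X_eq'` BY NAME). [cite: Balaban1985RegularSpaces, Lemma 1 – Thm 8 pp.79–101 (the leaf at the objects of record); p.77] -/
theorem upOfRecord₅CS_b8_iff_of_res_X_eq_subBP₂DPer (θ : Stage5Params F N) (R : B12.RunParams) (X₀ : PrintedCarriersR) (P : ℕ) (lam : ResidB8Per θ.toStage3Params P)
    (hX : θ.res.X R = X₀.withB8OfRecordSubBP₂DPer θ.toStage3Params P lam) :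
    (upOfRecord₅CS F N θ R).b8 ↔ B8LeafOfRecordSubBP₂DPer θ.toStage3Params P lam :=
  upOfRecord₅CS_b8_iff_of_res_X_eq' F N θ R hX

/-- At periodically pinned parameters the carrier law (1.36) ⊂ (1.62) HOLDS (periodic family of record), so OLD ⇒ NEW (`upOfRecord₅C` leaf AS TYPED ⇒ the S-binding's) is unconditional there.
[cite: Balaban1985RegularSpaces, (1.36) p.82, (1.62) p.87, Thm 8 p.101 (bookkeeping)] -/
theorem upOfRecord₅CS_pinB8SubBP₂DPer_b8_of_b8 (θ : Stage5Params F N) (P : ℕ) (lam : ResidB8Per θ.toStage3Params P) (R : B12.RunParams)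
    (h : (upOfRecord₅C F N (θ.pinB8SubBP₂DPer F N P lam) R).b8) : (upOfRecord₅CS F N (θ.pinB8SubBP₂DPer F N P lam) R).b8 :=
  upOfRecord₅CS_b8_of_upOfRecord₅C_b8 F N _ R (fun j b b₂ s U₀ U₁ h' => C136_C162_famB8OfRecordSubBP₂DPer lam.base.β lam.base.len P j b b₂ s U₀ U₁ h') h

end Pin

/-! ## §3. Sub-family readiness (the (E2) ∕ κ doors), the projections the chain feeds, Proposition 3 at the periodic δ₂-group -/

section SubFamily

variable {θ : Stage3Params} {P : ℕ}

/-- **THE SURVIVING LEAF PASSES TO SUB-FAMILIES** (pure logic, conjunct by conjunct, BY NAME): for every re-indexing `e : J → IdxB8SubDPer θ P` the leaf at the periodic group of record gives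
the leaf over `famB8OfRecordSubBP₂DPer θ β len P ∘ e` with the restricted axial map. [cite: Balaban1985RegularSpaces, Lemma 1 – Thm 8 pp.79–101 (bookkeeping: restriction of the family index)] -/
theorem b8LeafOfRecordSubBP₂DPer_precomp {J : Type} (e : J → IdxB8SubDPer θ P) (lam : ResidB8Per θ P) (h : B8LeafOfRecordSubBP₂DPer θ P lam) :
    B8LeafRS θ.D (θ.L : ℝ) lam.base.C₂ lam.base.B₁' lam.base.inp.B₀' lam.base.B₁ lam.base.B₂ lam.base.c₁ lam.base.inp lam.base.B₀β (blockPairNA θ.D θ.L θ.𝔸)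
      (fun j => famB8OfRecordSubBP₂DPer θ lam.base.β lam.base.len P (e j)) lam.base.lan lam.base.cub (fun j => lam.toAxial (e j)) where
  l1 := h.l1
  t2 := B8LeafKnit.thm2Printed_precomp e (fun j => (famB8OfRecordSubBP₂DPer θ lam.base.β lam.base.len P j).toGFData) h.t2
  p3 := B8LeafKnit.prop3Printed_precomp e θ.D (θ.L : ℝ) lam.base.C₂ lam.base.inp lam.base.B₀β (fun j => (famB8OfRecordSubBP₂DPer θ lam.base.β lam.base.len P j).toGFData2) h.p3
  t4 := B8LeafKnit.thm4Printed_precomp e lam.base.B₁' (fun j => (famB8OfRecordSubBP₂DPer θ lam.base.β lam.base.len P j).toGFData) h.t4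
  p5e := h.p5e
  p5u := h.p5u
  p6 := h.p6
  p7 := B8LeafKnit.prop7PrintedR_precomp e (famB8OfRecordSubBP₂DPer θ lam.base.β lam.base.len P) lam.toAxial h.p7
  t8 := B8Thm8Surviving.thm8SurvivingAt_precomp e 1 lam.base.B₁ lam.base.B₂ (famB8OfRecordSubBP₂DPer θ lam.base.β lam.base.len P) h.t8

/-- In particular for a SUB-INDEX cut out by a predicate `Q` on the periodic index. [cite: Balaban1985RegularSpaces, Lemma 1 – Thm 8 pp.79–101 (bookkeeping: restriction of the family index)] -/
theorem b8LeafOfRecordSubBP₂DPer_subtype (Q : IdxB8SubDPer θ P → Prop) (lam : ResidB8Per θ P) (h : B8LeafOfRecordSubBP₂DPer θ P lam) :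
    B8LeafRS θ.D (θ.L : ℝ) lam.base.C₂ lam.base.B₁' lam.base.inp.B₀' lam.base.B₁ lam.base.B₂ lam.base.c₁ lam.base.inp lam.base.B₀β (blockPairNA θ.D θ.L θ.𝔸)
      (fun j : {i : IdxB8SubDPer θ P // Q i} => famB8OfRecordSubBP₂DPer θ lam.base.β lam.base.len P j.1) lam.base.lan lam.base.cub (fun j => lam.toAxial j.1) :=
  b8LeafOfRecordSubBP₂DPer_precomp (fun j : {i : IdxB8SubDPer θ P // Q i} => j.1) lam h

/-- The projections the chain reads: Theorem 2's conjunct over the periodic δ₂-family (the target shape of dag-n05-c's transfer′ `thm2Printed_hp2per_of_zd` at `ι := IdxB8SubDPer.toZdIdx`).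
[cite: Balaban1985RegularSpaces, Thm 2 p.83, (1.35) p.82, (1.65)–(1.66) pp.87–88] -/
theorem b8LeafOfRecordSubBP₂DPer_t2 (lam : ResidB8Per θ P) (h : B8LeafOfRecordSubBP₂DPer θ P lam) :
    B8.Thm2Printed (fun j : IdxB8SubDPer θ P => (famB8OfRecordSubBP₂DPer θ lam.base.β lam.base.len P j).toGFData) :=
  h.t2

/-- Theorem 4's conjunct over the periodic δ₂-family, projected (the target shape of dag-n05-c's transfer′ `thm4Printed_hp2per_of_zd`). [cite: Balaban1985RegularSpaces, Thm 4 p.88] -/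
theorem b8LeafOfRecordSubBP₂DPer_t4 (lam : ResidB8Per θ P) (h : B8LeafOfRecordSubBP₂DPer θ P lam) :
    B8.Thm4Printed lam.base.B₁' (fun j : IdxB8SubDPer θ P => (famB8OfRecordSubBP₂DPer θ lam.base.β lam.base.len P j).toGFData) :=
  h.t4

/-- Theorem 8's surviving conjunct over the periodic δ₂-family, projected. [cite: Balaban1985RegularSpaces, Thm 8 (1.146) p.101] -/
theorem b8LeafOfRecordSubBP₂DPer_t8 (lam : ResidB8Per θ P) (h : B8LeafOfRecordSubBP₂DPer θ P lam) :
    B8Thm8Surviving.Thm8SurvivingAt 1 lam.base.B₁ lam.base.B₂ (famB8OfRecordSubBP₂DPer θ lam.base.β lam.base.len P) :=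
  h.t8

/-- **PROPOSITION 3's SENTENCE TRANSFERS FROM THE ℤᵈ δ₂-MEMBERS TO THE PERIODIC δ₂-MEMBERS OF RECORD** along any re-indexing `e : J → IdxB8SubDPer θ P` — P1′'s pure-∀ transfer
`B8LeafModelZdHP2Per.prop3Printed_hp2per_of_zd` at `ι := toZdIdx ∘ e`, `p := P` (the `GFData2` parts of `zdGF3HP₂` and `zdGF3P₂` agree by `rfl`, so D3₂'s `zdGF3P₂`-conclusion feeds it).
[cite: Balaban1985RegularSpaces, Prop. 3 p.87] -/
theorem prop3Printed_famB8OfRecordSubBP₂DPer_of_subBP₂D {J : Type} (e : J → IdxB8SubDPer θ P) {C₂ : ℝ} {inp : B8.B9Inputs} {B₀β : ℝ} (β : ℝ)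
    (len : B7Prop1Explicit.Site θ.D → ℝ)
    (h : B8.Prop3Printed θ.D (θ.L : ℝ) C₂ inp B₀β (fun a : J => (zdGF3P₂ θ.𝔸 θ.L β len (e a).toZdIdx).toGFData2)) :
    B8.Prop3Printed θ.D (θ.L : ℝ) C₂ inp B₀β (fun a : J => (famB8OfRecordSubBP₂DPer θ β len P (e a)).toGFData2) :=
  B8LeafModelZdHP2Per.prop3Printed_hp2per_of_zd (fun a : J => (e a).toZdIdx) (fun _ => P) h

/-- **THE LEAF's PROPOSITION-3 CONJUNCT AT THE PERIODIC δ₂-GROUP FOLLOWS FROM THE ℤᵈ δ₂-SLOT's** (`CarriersB8SubBP2D.B8LeafOfRecordSubBP₂D.p3P₂` ∘ `B8LeafKnit.prop3Printed_precomp` along `toSubD`,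
then the pure-∀ transfer). [cite: Balaban1985RegularSpaces, Prop. 3 p.87] -/
theorem b8LeafOfRecordSubBP₂DPer_p3_of_subBP₂D (lam : ResidB8Per θ P) (h : B8LeafOfRecordSubBP₂D θ lam.base) :
    B8.Prop3Printed θ.D (θ.L : ℝ) lam.base.C₂ lam.base.inp lam.base.B₀β (fun j : IdxB8SubDPer θ P => (famB8OfRecordSubBP₂DPer θ lam.base.β lam.base.len P j).toGFData2) :=
  prop3Printed_famB8OfRecordSubBP₂DPer_of_subBP₂D (fun j : IdxB8SubDPer θ P => j) lam.base.β lam.base.len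
    (B8LeafKnit.prop3Printed_precomp (fun j : IdxB8SubDPer θ P => j.toSubD) θ.D (θ.L : ℝ) lam.base.C₂ lam.base.inp lam.base.B₀β
      (fun i : IdxB8SubD θ => (zdGF3P₂ θ.𝔸 θ.L lam.base.β lam.base.len i.1.1.1.1).toGFData2) h.p3P₂)

/-- ★ **PROPOSITION 3 AT THE PERIODIC δ₂-FAMILY OF RECORD**, modulo dag-n06-b's BOTH-POINTS Prop.-3-frame socket `SockB9P3H2` ([Balaban1985BackgroundPropagators] Thm 3.3 read through
(1.57)–(1.59), the Hölder line over pairs with both points in `Ω_j`) AT PRINT's CLASS `towerBondsP` AND AT THE PERIODIC MEMBERS ONLY — dag-n05-d's D3₂ `B8Prop3PrintedZdGF3P2Gamma.prop3Printed_zdGF3P₂_map_γ`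
at `ι := IdxB8SubDPer.toZdIdx`, carried to periodic data by the pure-∀ transfer: for `θ.D ≥ 2`, `C₂ ≥ 2097152(d+1)²L²`, `B₀(β₀) ≥ 0`.  (The H2 ∕ δ₂ suppliers' currency; the PERIODIC-GUARDED
edition of this socket is the next junction word.) [cite: Balaban1985RegularSpaces, Prop. 3 p.87, (1.36)–(1.40) pp.82–83, (1.59) p.86, p.77 («Ω_j ⊂ T_η»); Balaban1985BackgroundPropagators, Thm 3.3 p.399, (3.40) p.397] -/
theorem prop3_famB8OfRecordSubBP₂DPer (hD : 2 ≤ θ.D) (inp : B8.B9Inputs) {B₀β C₂ cP : ℝ} (hB₀β : 0 ≤ B₀β) (hC₂ : 2097152 * ((θ.D : ℝ) + 1) ^ 2 * (θ.L : ℝ) ^ 2 ≤ C₂)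
    (hcP : 0 < cP) (β : ℝ) (len : B7Prop1Explicit.Site θ.D → ℝ)
    (SB9P : ∀ j : IdxB8SubDPer θ P, SockB9P3H2 (𝔸 := θ.𝔸) θ.L inp.B₀ B₀β cP β len j.toZdIdx.η j.toZdIdx.k j.toZdIdx.Ω j.toZdIdx.Λs
      (fun m l => towerBondsP θ.L j.toZdIdx.Ω (j.toZdIdx.Λs m) l)) :
    B8.Prop3Printed θ.D (θ.L : ℝ) C₂ inp B₀β (fun j : IdxB8SubDPer θ P => (famB8OfRecordSubBP₂DPer θ β len P j).toGFData2) :=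
  prop3Printed_famB8OfRecordSubBP₂DPer_of_subBP₂D (fun j : IdxB8SubDPer θ P => j) β len
    (B8Prop3PrintedZdGF3P2Gamma.prop3Printed_zdGF3P₂_map_γ hD θ.two_le_L inp hB₀β hC₂ hcP β len (fun j : IdxB8SubDPer θ P => j.toZdIdx) SB9P)

end SubFamily

end Literature.MathematicalPhysics.QuantumFieldTheory.Balaban1983to89.Node00

end
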